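import Literature.MathematicalPhysics.QuantumFieldTheory.Balaban1983to89.B8Eq131Cubes
import Literature.MathematicalPhysics.QuantumFieldTheory.Balaban1983to89.B8Eq131DomainSeq

/-!
# `Balaban1983to89.B8Eq131CubesAdmissible` — [Balaban1985RegularSpaces] p. 99: «The sequence of cubes {□_j} is an
# admissible family of subsets satisfying (1.3), (1.4)» PROVED for the Sect. F cube family of `B8Eq131Cubes` on the `ℤᵈ`
# carriers — the metric clause of (1.4) with `R₁M₁` (sup- and `ℓ¹`-form), the big-block clause, the admissibility record
# `B8ConstraintBonds.DomainSeq`, the identification of print's `Λ′_j` (1.131) with the (1.5)-territories of the family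
# `(T, □₁, …, □_k)`, and the (1.31)/(1.37)/(1.42) crossing-bond statements of `B8Eq131DomainSeq` ON THIS FAMILY with the
# block geometry derived (no `hblock`, no `DomainSeq` hypothesis left)

statement-level skeleton of published theorems with citation tags; proofs where landed; nothing here is a claim
about the Yang–Mills mass gap

PDF held: `paper:balaban1985-cmp99-regular-spaces-gauge-fixing` (journal page = PDF page + 74); pages read for this module
from the `lit read` text layer this session: p. 77 [PDF 3] ((1.3)–(1.6)), p. 98 [PDF 24] (construction of `□_j`), p. 99
[PDF 25] (the sentence above, (1.131)–(1.133)).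

CITATION HEADER (lean-in-tree rule).  Cell `lit-balaban` (HOME `run/shared/lean/pub/lit-balaban/`), unit `lit-balaban-r05`
gen 56 (B8 fold owner; free-target protocol G.5-34(d)).  SKELETON rows served (members only, no head change): **B8.Eq1.131**
((1.131); the row's «admissibility of the cube family» clause so far pointed at the toy one-cube family
`B8ConstraintBonds.cubeSeq_domainSeq`; the parent `B8Eq131Cubes` states in its HONEST SCOPE «NOT asserted: that {□_j} itself
satisfies (1.4) … its boundary separations are R₁M₁Lʲη, i.e. (1.4) with R₁M₁ for RM₁; only the nesting and the block structure
are proved here» — THIS module proves it), **B8.Eq1.3** / **B8.Eq1.5** ((1.3)–(1.6) record instantiated), **B8.Eq1.31** /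
**B8.Eq1.36** ((1.31) second line, (1.37) «Q_j(U₀, ηA) = B», (1.42)-clause at a crossing bond ON THE SECT. F FAMILY, geometry
derived), input of **B8.Prop6** (print applies Theorem 4 — whose proof runs through (1.31)/(1.37) — to the pair `1, U₀″` on
`{□_j}`).  Kind «kernel-checked proof»; one definition with a body (`cubeFam`, the family as a map `ℕ → Set`), theorems
otherwise; no `… : Prop` fact; no existing module is modified.  REUSED BY NAME: `B8Eq131Cubes.cube/sqLo/sqHi/inLo/inHi/
LamP/bLo/bHi/gs/flm/under_flm/mem_cube_iff/cube_eq/margin_succ/cube_succ_subset/inner_eq_blowup/l1dist`,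
`B8ConstraintBonds.DomainSeq/Lam/IsLevel`, `B8Eq131DomainSeq.block_mem_Lam_of_crossing(_mirrored)/
not_mem_succ_of_mem_Lam_smul/isLevel_pow_smul`, `B8Eq131Derivation.eq131_crossing/eq87_of_inAx_restr129`,
`B8Eq137QjEqB.Qj_eq_Bcross_of_inAx_restr129/Qj_eq_BcrossMirror_of_inAx_restr129/norm_Qj_lt_crossing_of_inAx_restr129`,
`QuantumLattice.blockMap`.

WHAT IS PRINTED (text layer, verbatim up to OCR).  p. 77: *"Ω₀ ⊃ Ω₁ ⊃ Ω₂ ⊃ … ⊃ Ω_k, Ω_j ⊂ T_η, j = 0, 1, …, k, (1.3) which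
satisfy the following conditions: Ω_j = Bʲ(Ω_j^{(j)}), Ω_j is a sum of cubes of a size M₁Lʲη, (Lʲη)⁻¹dist(Ω_jᶜ, Ω_{j+1}) >
RM₁. (1.4) The number M₁ is a size of big blocks and was fixed in [4]. … We assume that R is a sufficiently large positive
integer (a power of L), so that all the theorems on propagators in [2, 4] hold for RM₁. … Λ_j = Ω_j^{(j)} ∖ Ω_{j+1}^{(j)} (1.5) …
we admit the case where some domains Ω_j are equal to T_η"*.  p. 98: *"we assume that it [□] is a union of cubes of the size
R₁M₁Lʲη, where R₁, M₁ are smallest integers for which all the theorems of the papers [2, 4] are valid. … we take a size of □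
equal to MLʲη, where M is a multiple of R₁M₁. … so we can assume that k ≥ 1. Let us take a sequence of cubes □₀, □₁, …,
□_{k−1}, □_k, □, such that □_j ⊃ □_{j+1} and a distance between boundaries of these cubes is equal to R₁M₁Lʲη. … for every j
the cube □_j is a sum of the big blocks of the lattice T_{L^{−j}}."*  p. 99: *"The sequence of cubes {□_j} is an admissible
family of subsets satisfying (1.3), (1.4), □_k ⊂ Ω_{k−1}, □_j ⊂ Ω_j, j < k. Let us define Λ′_j = □_j^{(j)} ∖ □_{j+1}^{(j)},
j = 1, …, k − 1, Λ′_k = □_k^{(k)}, Λ′₀ = T ∖ □₁, ℭ_k = ⋃_{j=0}^{k} Λ′_j, (1.131) … U₀″ ∈ 𝔄_k({□_j}, L³α₀) ∩ Ax_k(ℭ_k, 1), (1.132)"*.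

READING (recorded, nothing inferred).  The separation of consecutive cubes is `R₁M₁Lʲη` (p. 98), so (1.4) holds for `{□_j}`
with the MINIMAL admissible constant `R₁M₁` of p. 98 in the place of `RM₁` (print: the theorems of [2, 4] are valid from
`R₁M₁` on) — as lattice point sets, sites outside `□_j` and sites of `□_{j+1}` are `≥ R₁M₁Lʲ + 1` fine sites apart
(`sep_cube`), i.e. `(Lʲη)⁻¹dist(□_jᶜ, □_{j+1}) > R₁M₁`.  Two nested families occur on p. 99: `{□_j}_{j=0}^{k}` (the argument
of `𝔄_k` in (1.132)) and `(T, □₁, …, □_k)` (whose (1.5)-territories are exactly the `Λ′_j` of (1.131): `Λ′₀ = T ∖ □₁`); both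
are typed (one map `cubeFam top …`, the switch `top` choosing `Ω₀ = T` or `Ω₀ = □₀`), both are admissible
(`cubeFam_domainSeq`).

WHAT THIS MODULE PROVES (all statements kernel-checked, 0 sorry; `ρ` stands for `R₁M₁`, `a`/`M` the lower corner/side
of `□^{(k)}`, as in `B8Eq131Cubes`).
§1 Tower arithmetic: `inBox_tower_smul_iff` (`Lʲ•y ∈ [tlo (n+j), thi (n+j)] ⇔ y ∈ [tlo n, thi n]`), `smul_mem_cube_iff`
   (`Lʲ•y ∈ □_j ⇔ y ∈ □_j^{(j)}`), `smul_mem_cube_succ_iff` (`Lʲ•y ∈ □_{j+1} ⇔ y ∈ □_{j+1}^{(j)}`), `blockMap_pow_eq_flm`,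
   `flm_eq_of_under`.
§2 **(1.4), metric clause, AS PRINTED WITH `R₁M₁`**: `sep_cube` (`x ∉ □_j`, `x′ ∈ □_{j+1}`, `j < k` ⇒ `∃ μ, ρLʲ + 1 ≤
   |x_μ − x′_μ|`), `sep_cube_l1` (`ρLʲ < l1dist x x′`, the `ℓ¹` shape of `B8Eq131Cubes.tcube_subset_of_sep`'s `hsep`),
   `add_mem_cube_of_mem_succ` (the collar form: `x ∈ □_{j+1}`, `|t|_∞ ≤ ρLʲ` ⇒ `x + t ∈ □_j`).
§3 **(1.4), big-block clause** «Ω_j is a sum of cubes of a size M₁Lʲη»: `sq_blockSat` — if `b ∣ ρ`, `b ∣ a_μ`, `b ∣ M`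
   (print: `□` a union of `R₁M₁`-cubes, `M` a multiple of `R₁M₁`, `b = M₁ ∣ R₁M₁ = ρ`) then membership in `□_j^{(j)}`
   depends only on the `b`-block `blockMap b`.
§4 **THE ADMISSIBILITY RECORD**: `cubeFam top L a M ρ k` = the map `j ↦ Ω_j` (`Ω₀ = □₀`, or `T = univ` when `top`; `Ω_j =
   □_j`, `1 ≤ j ≤ k`; `∅` beyond `k`) and **`cubeFam_domainSeq : DomainSeq L (cubeFam top L a M ρ k)`** for `1 ≤ L ≤ ρ`
   (nesting (1.3) = `cube_succ_subset`; saturation «Ω_j = Bʲ(Ω_j^{(j)})» = `mem_cube_iff`; the record's `L^{j+1}`-collar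
   from §2 and `L ≤ R₁M₁`); `cubeFam_false_of_le` + `inAk_cubeFam_iff` (§6): the family of «𝔄_k({□_j}, L³α₀)» in (1.132), as
   fed to `B8Ineq132.InAk` by `B8Eq131Cubes.ineq132_cubes`, IS this record's family on the levels `j ≤ k` that `𝔄_k` reads.
§5 **(1.131) = (1.5) FOR THE FAMILY `(T, □₁, …, □_k)`**: `smul_mem_Lam_cubeFam_iff` — for `j ≤ k`, `1 ≤ k`:
   `Lʲ•y ∈ Lam L (cubeFam true …) j ⇔ y ∈ LamP L a M ρ k j` (print's `Λ′_j`, incl. `Λ′₀ = T ∖ □₁`, `Λ′_k = □_k^{(k)}`).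
§6 CONSEQUENCES ON THE FAMILY (the `hblock`/`DomainSeq`/`hΛ` hypotheses of the parents DISCHARGED; the analytic hypotheses
   — [3] Prop. 4's regime, (1.19) `InAx`, (1.29) `Restr129` over `Λ′` — verbatim): `hblock_cubes`, `hblock_cubes_mirrored`
   («All sites of the contours Γ_{b₋,x} belong to Λ′_{j−1}»), **`eq131_crossing_cubes`** ((1.31) second line),
   **`Qj_eq_Bcross_cubes`**, **`Qj_eq_BcrossMirror_cubes`** ((1.37) «Q_j(U₀, ηA) = B»), **`norm_Qj_lt_crossing_cubes`**
   ((1.42) clause `|Q_j(U₀, ηA)| < 2dLα₁`), at every crossing bond of levels `j + 1 ≤ k` of `{□_j}`.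

HONEST SCOPE.  (i) `ℤᵈ` record (`B8ConstraintBonds.DomainSeq`: nesting, `Lʲ`-block saturation, ONE `L^{j+1}`-collar), not
print's `T_η`; the metric clause is proved in the sup form per coordinate and in `ℓ¹`; «dist» of (1.4) is between lattice
point sets.  (ii) Constants: (1.4) holds for `{□_j}` with `R₁M₁` (print's minimal admissible constant) in the place of `RM₁`,
exactly as constructed on p. 98 — NOT with the separation constant `RM₁` of the ambient family `{Ω_j}` (print p. 98: «RM is
bigger than R₁M₁»); the record needs `L ≤ R₁M₁` (print: the constants are large, `R` «a power of L»).  (iii) The big-block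
clause is proved under the divisibilities print states (`□` a union of `R₁M₁`-cubes, `M ∈ R₁M₁ℕ`) for any block size
`b ∣ R₁M₁`.  (iv) `k ≥ 1` (p. 98 «so we can assume that k ≥ 1») enters §5 at `j = 0` only.  (v) Nothing here is progress on
`Summit.QuantumFields`; the value is that the Sect. F family now carries the admissibility (1.3)–(1.4) and the (1.31)/(1.37)
crossing geometry as theorems, not hypotheses.

[cite: Balaban1985RegularSpaces, p.99 («The sequence of cubes {□_j} is an admissible family of subsets satisfying (1.3),
(1.4)»), (1.131) p.99, (1.3)–(1.6) p.77, p.98 (construction of □_j), (1.31) p.82, (1.37) p.82, (1.42) p.83]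
-/

noncomputable section

open NormedSpace Finset Complex

namespace Literature.MathematicalPhysics.QuantumFieldTheory.Balaban1983to89.B8Eq131CubesAdmissible

open Literature.MathematicalPhysics.QuantumLattice (blockMap blockBase blockMap_blockBase_add_of_lt)
open B7Prop1Explicit B7Prop2Explicit MatrixLog B7Eq92Concrete B7Eq99Concrete B7Eq84Concrete B7AvgGaugeCovariance
open B7Prop3Flat (expCfg c3)
open B7Prop4GeneralLevels (logCovIter)
open B7Prop1Local (InBox)
open B8Lemma1NonAbelian (pert)
open B8Thm2LogB (blockTop crossMid Bcross BcrossMirror)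
open B8Ineq130 (tlo thi tlo_apply thi_apply)
open B8Ineq132 (Under)
open B8Eq131Cubes (cube sqLo sqHi inLo inHi LamP bLo bHi gs flm under_flm mem_cube_iff cube_eq margin_succ
  cube_succ_subset inner_eq_blowup l1dist)
open B8Eq131Derivation (eq131_crossing eq87_of_inAx_restr129)
open B8Eq119TwistedAxial (InAx Restr129)
open B8ConstraintBonds (DomainSeq Lam IsLevel)
open B8Eq131DomainSeq (block_mem_Lam_of_crossing block_mem_Lam_of_crossing_mirrored not_mem_succ_of_mem_Lam_smul
  isLevel_pow_smul)
open B8Eq137QjEqB (Qj_eq_Bcross_of_inAx_restr129 Qj_eq_BcrossMirror_of_inAx_restr129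
  norm_Qj_lt_crossing_of_inAx_restr129)

-- `Site` alone would resolve to the torus sites of `Setup.lean`; re-export the `ℤ^d` sites of `B7Prop1Explicit`.
export B7Prop1Explicit (Site)

variable {d : ℕ}

/-! ## §1 Tower arithmetic: reading a level-`j` site `y` as the fine point `Lʲ•y` -/

/-- **Scaling in the tower of cubes**: the fine point `Lʲ•y` lies in the depth-`(n + j)` cube of the tower of `B8Ineq130`
iff `y` lies in the depth-`n` cube. [cite: Balaban1985RegularSpaces, p.98 («for every j the cube □_j is a sum of the big blocks of the lattice T_{L^{−j}}»)] -/
theorem inBox_tower_smul_iff {L : ℕ} (hL : 1 ≤ L) (lo hi : Site d) (n j : ℕ) (y : Site d) :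
    InBox (tlo L lo (n + j)) (thi L hi (n + j)) (((L : ℤ) ^ j) • y) ↔ InBox (tlo L lo n) (thi L hi n) y := by
  have hLj : (0 : ℤ) < (L : ℤ) ^ j := pow_pos (by exact_mod_cast hL) j
  have key : ∀ i, (tlo L lo (n + j) i ≤ (L : ℤ) ^ j * y i ∧ (L : ℤ) ^ j * y i ≤ thi L hi (n + j) i) ↔
      (tlo L lo n i ≤ y i ∧ y i ≤ thi L hi n i) := by
    intro i
    rw [tlo_apply, thi_apply, tlo_apply, thi_apply, pow_add]
    constructor
    · rintro ⟨h1, h2⟩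
      constructor
      · have h3 : (L : ℤ) ^ j * ((L : ℤ) ^ n * lo i) ≤ (L : ℤ) ^ j * y i := by linarith [mul_comm ((L : ℤ) ^ n) ((L : ℤ) ^ j)]
        exact le_of_mul_le_mul_left h3 hLj
      · have h3 : (L : ℤ) ^ j * y i < (L : ℤ) ^ j * ((L : ℤ) ^ n * (hi i + 1)) := by
          nlinarith [mul_comm ((L : ℤ) ^ n) ((L : ℤ) ^ j)]
        have h4 := lt_of_mul_lt_mul_left h3 hLj.le
        linarith
    · rintro ⟨h1, h2⟩
      constructor
      · have h3 : (L : ℤ) ^ j * ((L : ℤ) ^ n * lo i) ≤ (L : ℤ) ^ j * y i := mul_le_mul_of_nonneg_left h1 hLj.le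
        nlinarith [mul_comm ((L : ℤ) ^ n) ((L : ℤ) ^ j)]
      · have h3 : (L : ℤ) ^ j * (y i + 1) ≤ (L : ℤ) ^ j * ((L : ℤ) ^ n * (hi i + 1)) :=
          mul_le_mul_of_nonneg_left (by linarith) hLj.le
        nlinarith [mul_comm ((L : ℤ) ^ n) ((L : ℤ) ^ j)]
  constructor
  · intro h i
    have hi := h i
    simp only [Pi.smul_apply, smul_eq_mul] at hi
    exact (key i).mp hi
  · intro h i
    have hi := (key i).mpr (h i)
    simp only [Pi.smul_apply, smul_eq_mul]
    exact hi

/-- **`Lʲ•y ∈ □_j ⇔ y ∈ □_j^{(j)}`** (`□_j = Bʲ(□_j^{(j)})` read at a block corner). [cite: Balaban1985RegularSpaces, (1.4) p.77 («Ω_j = Bʲ(Ω_j^{(j)})»), p.98] -/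
theorem smul_mem_cube_iff {L : ℕ} (hL : 1 ≤ L) (a : Site d) (M ρ k j : ℕ) (y : Site d) :
    ((L : ℤ) ^ j) • y ∈ cube L a M ρ k j ↔ InBox (sqLo L a ρ k j) (sqHi L a M ρ k j) y := by
  have h := inBox_tower_smul_iff hL (sqLo L a ρ k j) (sqHi L a M ρ k j) 0 j y
  simp only [Nat.zero_add, B8Ineq130.tlo_zero, B8Ineq130.thi_zero] at h
  exact h

/-- **`Lʲ•y ∈ □_{j+1} ⇔ y ∈ □_{j+1}^{(j)} = B(□_{j+1}^{(j+1)})`** (`j < k`; the inner box of `Λ′_j` in (1.131)). [cite: Balaban1985RegularSpaces, (1.131) p.99 («Λ′_j = □_j^{(j)} ∖ □_{j+1}^{(j)}»)] -/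
theorem smul_mem_cube_succ_iff {L : ℕ} (hL : 1 ≤ L) (a : Site d) (M ρ : ℕ) {k j : ℕ} (hj : j < k) (y : Site d) :
    ((L : ℤ) ^ j) • y ∈ cube L a M ρ k (j + 1) ↔ InBox (inLo L a ρ k j) (inHi L a M ρ k j) y := by
  obtain ⟨h1, h2⟩ := inner_eq_blowup (L := L) a M ρ hj
  have h := inBox_tower_smul_iff hL (sqLo L a ρ k (j + 1)) (sqHi L a M ρ k (j + 1)) 1 j y
  rw [Nat.add_comm 1 j] at h
  rw [h1, h2]
  exact h

/-- The prelude's block map at block size `Lᵐ` is `B8Eq131Cubes.flm`. [folklore] -/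
private theorem blockMap_pow_eq_flm (L m : ℕ) (x : Site d) : blockMap (L ^ m) x = flm L m x := by
  funext i
  simp [blockMap, flm]

/-- `z ∈ Bᵐ(x)` determines `x`: `flm L m z = x`. [folklore] -/
private theorem flm_eq_of_under {L : ℕ} {m : ℕ} {x z : Site d} (hz : Under L m x z) : flm L m z = x := by
  rw [← blockMap_pow_eq_flm]
  have ht : z = blockBase (L ^ m) x + (z - blockBase (L ^ m) x) := by abel
  rw [ht]
  refine blockMap_blockBase_add_of_lt (L ^ m) x _ (fun i => ?_) (fun i => ?_)
  · have h := (hz i).1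
    simp only [Pi.sub_apply, blockBase, Nat.cast_pow]
    linarith
  · have h := (hz i).2
    simp only [Pi.sub_apply, blockBase, Nat.cast_pow]
    linarith

/-! ## §2 (1.4), the metric clause for `{□_j}` with `R₁M₁`: `(Lʲη)⁻¹dist(□_jᶜ, □_{j+1}) > R₁M₁` -/

/-- **(1.4) FOR THE CUBE FAMILY, AS PRINTED WITH `R₁M₁`** (sup form): for `j < k`, a site outside `□_j` and a site of
`□_{j+1}` differ in some coordinate by at least `R₁M₁Lʲ + 1` fine sites — «a distance between boundaries of these cubes
is equal to R₁M₁Lʲη», hence `(Lʲη)⁻¹dist(□_jᶜ, □_{j+1}) > R₁M₁`. [cite: Balaban1985RegularSpaces, (1.4) p.77 («(Lʲη)⁻¹dist(Ω_jᶜ, Ω_{j+1}) > RM₁»), p.98 («a distance between boundaries of these cubes is equal to R₁M₁Lʲη»), p.99 («satisfying (1.3), (1.4)»)] -/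
theorem sep_cube {L : ℕ} {a : Site d} {M ρ k j : ℕ} (hj : j < k) {x x' : Site d}
    (hx : x ∉ cube L a M ρ k j) (hx' : x' ∈ cube L a M ρ k (j + 1)) :
    ∃ i, ((ρ * L ^ j : ℕ) : ℤ) + 1 ≤ |x i - x' i| := by
  rw [cube_eq hj.le] at hx
  rw [cube_eq (Nat.succ_le_of_lt hj)] at hx'
  simp only [Set.mem_setOf_eq, InBox, not_forall] at hx
  obtain ⟨i, hi⟩ := hx
  refine ⟨i, ?_⟩
  obtain ⟨h1, h2⟩ := hx' i
  have hm : ((L ^ j * (ρ * gs L (k - j)) : ℕ) : ℤ) = ((L ^ (j + 1) * (ρ * gs L (k - (j + 1))) : ℕ) : ℤ) + ((ρ * L ^ j : ℕ) : ℤ) := by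
    rw [margin_succ hj]; push_cast; ring
  simp only [bLo, bHi] at h1 h2 hi
  rw [hm] at hi
  rcases not_and_or.mp hi with hlo | hhi
  · have h3 := not_le.mp hlo
    rw [abs_of_nonpos (by linarith)]
    linarith
  · have h3 := not_le.mp hhi
    rw [abs_of_nonneg (by linarith)]
    linarith

/-- **(1.4) for the cube family, `ℓ¹` form** `R₁M₁Lʲ < l1dist x x′` (`x ∉ □_j`, `x′ ∈ □_{j+1}`, `j < k`) — the shape of the
separation hypothesis `hsep` of `B8Eq131Cubes.tcube_subset_of_sep`, so that `{□_j}` can itself serve as the ambient family of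
Sect. F. [cite: Balaban1985RegularSpaces, (1.4) p.77, p.98, p.99 («satisfying (1.3), (1.4)»)] -/
theorem sep_cube_l1 {L : ℕ} {a : Site d} {M ρ k j : ℕ} (hj : j < k) {x x' : Site d}
    (hx : x ∉ cube L a M ρ k j) (hx' : x' ∈ cube L a M ρ k (j + 1)) :
    ((ρ * L ^ j : ℕ) : ℤ) < l1dist x x' := by
  obtain ⟨i, hi⟩ := sep_cube hj hx hx'
  have hle : |x i - x' i| ≤ l1dist x x' := by
    unfold l1dist
    exact Finset.single_le_sum (f := fun i' => |x i' - x' i'|) (fun i' _ => abs_nonneg _) (Finset.mem_univ i)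
  linarith

/-- **The collar form of (1.4) for the cube family**: a site of `□_{j+1}` moved by a vector of sup-norm `≤ R₁M₁Lʲ` stays in
`□_j` (`j < k`). [cite: Balaban1985RegularSpaces, (1.4) p.77, p.98 («a distance between boundaries of these cubes is equal to R₁M₁Lʲη»)] -/
theorem add_mem_cube_of_mem_succ {L : ℕ} {a : Site d} {M ρ k j : ℕ} (hj : j < k) {x t : Site d}
    (hx : x ∈ cube L a M ρ k (j + 1)) (ht : ∀ i, |t i| ≤ ((ρ * L ^ j : ℕ) : ℤ)) : x + t ∈ cube L a M ρ k j := by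
  rw [cube_eq (Nat.succ_le_of_lt hj)] at hx
  rw [cube_eq hj.le]
  have hm : ((L ^ j * (ρ * gs L (k - j)) : ℕ) : ℤ) = ((L ^ (j + 1) * (ρ * gs L (k - (j + 1))) : ℕ) : ℤ) + ((ρ * L ^ j : ℕ) : ℤ) := by
    rw [margin_succ hj]; push_cast; ring
  intro i
  obtain ⟨h1, h2⟩ := hx i
  have h3 := ht i
  rw [abs_le] at h3
  simp only [bLo, bHi, Pi.add_apply] at h1 h2 ⊢
  rw [hm]
  constructor <;> linarith

/-! ## §3 (1.4), the big-block clause: «Ω_j is a sum of cubes of a size M₁Lʲη» for `{□_j}` -/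

/-- **(1.4), BIG-BLOCK CLAUSE FOR THE CUBE FAMILY**: if the block size `b` divides `ρ = R₁M₁`, the lower corner `a` and the
side `M` of `□^{(k)}` (print: «[□] is a union of cubes of the size R₁M₁Lʲη», «M is a multiple of R₁M₁», `b = M₁`), then
`□_j^{(j)}` is a union of `b`-blocks of its lattice: membership depends only on `blockMap b`. [cite: Balaban1985RegularSpaces, (1.4) p.77 («Ω_j is a sum of cubes of a size M₁Lʲη»), p.98 («a union of cubes of the size R₁M₁Lʲη, … M is a multiple of R₁M₁»)] -/
theorem sq_blockSat {L : ℕ} {a : Site d} {M ρ k j b : ℕ} (hb : 1 ≤ b) (hbρ : b ∣ ρ) (hba : ∀ i, (b : ℤ) ∣ a i)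
    (hbM : b ∣ M) {z z' : Site d} (hzz' : blockMap b z = blockMap b z')
    (hz : InBox (sqLo L a ρ k j) (sqHi L a M ρ k j) z) : InBox (sqLo L a ρ k j) (sqHi L a M ρ k j) z' := by
  have hb0 : (0 : ℤ) < (b : ℤ) := by exact_mod_cast hb
  intro i
  have hq : z i / (b : ℤ) = z' i / (b : ℤ) := by
    have := congr_fun hzz' i
    simpa [blockMap] using this
  obtain ⟨h1, h2⟩ := hz i
  -- the two corners are multiples of `b`
  have hlo : (b : ℤ) ∣ sqLo L a ρ k j i := by
    simp only [sqLo, bLo]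
    refine dvd_sub (dvd_mul_of_dvd_right (hba i) _) ?_
    push_cast
    exact dvd_mul_of_dvd_left (by exact_mod_cast hbρ) _
  have hhi : (b : ℤ) ∣ sqHi L a M ρ k j i + 1 := by
    simp only [sqHi, bHi]
    have e : (L : ℤ) ^ (k - j) * (a i + (M : ℤ)) - 1 + ((ρ * gs L (k - j) : ℕ) : ℤ) + 1
        = (L : ℤ) ^ (k - j) * (a i + (M : ℤ)) + ((ρ * gs L (k - j) : ℕ) : ℤ) := by ring
    rw [e]
    refine dvd_add (dvd_mul_of_dvd_right (dvd_add (hba i) (by exact_mod_cast hbM)) _) ?_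
    push_cast
    exact dvd_mul_of_dvd_left (by exact_mod_cast hbρ) _
  obtain ⟨q, hq1⟩ := hlo
  obtain ⟨q', hq2⟩ := hhi
  constructor
  · -- `q·b ≤ z_i` ⇒ `q ≤ z_i / b = z′_i / b` ⇒ `q·b ≤ z′_i`
    rw [hq1] at h1 ⊢
    have h3 : q ≤ z i / (b : ℤ) := by
      rw [Int.le_ediv_iff_mul_le hb0, mul_comm]; exact h1
    rw [hq] at h3
    have h4 := Int.le_ediv_iff_mul_le hb0 |>.mp h3
    linarith [mul_comm q (b : ℤ)]
  · -- `z_i < q′·b` ⇒ `z_i / b < q′` ⇒ `z′_i < q′·b`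
    have h3 : z i < (b : ℤ) * q' := by linarith
    have h4 : z i / (b : ℤ) < q' := by
      rw [Int.ediv_lt_iff_lt_mul hb0, mul_comm]; exact h3
    rw [hq] at h4
    have h5 := (Int.ediv_lt_iff_lt_mul hb0).mp h4
    linarith [mul_comm q' (b : ℤ)]

/-! ## §4 The admissibility record `B8ConstraintBonds.DomainSeq` of the cube family -/

/-- **THE SECT. F FAMILY AS A DOMAIN SEQUENCE** `j ↦ Ω_j`: `Ω₀ = □₀` (`top = false`, the family `{□_j}_{j=0}^{k}` of
«𝔄_k({□_j}, L³α₀)» in (1.132)) or `Ω₀ = T` (`top = true`, the family `(T, □₁, …, □_k)` whose (1.5)-territories are the `Λ′_j`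
of (1.131), «we admit the case where some domains Ω_j are equal to T_η»); `Ω_j = □_j` for `1 ≤ j ≤ k`; `Ω_j = ∅` beyond `k`
(harmless, `B8ConstraintBonds.DomainSeq` docstring). [cite: Balaban1985RegularSpaces, p.99 («The sequence of cubes {□_j} is an admissible family»), (1.131) p.99, (1.3) p.77] -/
def cubeFam (top : Bool) (L : ℕ) (a : Site d) (M ρ k : ℕ) : ℕ → Set (Site d) := fun j =>
  if j ≤ k then (if top ∧ j = 0 then Set.univ else cube L a M ρ k j) else ∅

/-- `Ω_j = □_j` for `1 ≤ j ≤ k`. [cite: Balaban1985RegularSpaces, p.99, (1.3) p.77] -/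
theorem cubeFam_of_pos (top : Bool) (L : ℕ) (a : Site d) (M ρ : ℕ) {k j : ℕ} (h1 : 1 ≤ j) (hj : j ≤ k) :
    cubeFam top L a M ρ k j = cube L a M ρ k j := by
  have : ¬ (top ∧ j = 0) := fun h => by omega
  simp [cubeFam, hj, this]

/-- `Ω_j = ∅` for `k < j`. [cite: Balaban1985RegularSpaces, (1.3) p.77, dictionary] -/
theorem cubeFam_of_lt (top : Bool) (L : ℕ) (a : Site d) (M ρ : ℕ) {k j : ℕ} (hj : k < j) :
    cubeFam top L a M ρ k j = ∅ := by
  have : ¬ j ≤ k := by omega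
  simp [cubeFam, this]

/-- `Ω₀ = □₀` for the family `{□_j}_{j=0}^{k}`. [cite: Balaban1985RegularSpaces, p.98 («□₀, □₁, …, □_{k−1}, □_k»)] -/
theorem cubeFam_false_zero (L : ℕ) (a : Site d) (M ρ k : ℕ) : cubeFam false L a M ρ k 0 = cube L a M ρ k 0 := by
  simp [cubeFam]

/-- `Ω_j = □_j` for every `j ≤ k` in the family `{□_j}_{j=0}^{k}` — the family `B8Eq131Cubes.cube L a M ρ k` fed to
`𝔄_k` by `B8Eq131Cubes.ineq132_cubes` ((1.132)), on the levels `j ≤ k` that `𝔄_k` reads. [cite: Balaban1985RegularSpaces, (1.132) p.99 («U₀″ ∈ 𝔄_k({□_j}, L³α₀)»), p.98] -/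
theorem cubeFam_false_of_le (L : ℕ) (a : Site d) (M ρ : ℕ) {k j : ℕ} (hj : j ≤ k) :
    cubeFam false L a M ρ k j = cube L a M ρ k j := by
  simp [cubeFam, hj]

/-- `Ω₀ = T` for the family `(T, □₁, …, □_k)`. [cite: Balaban1985RegularSpaces, (1.131) p.99 («Λ′₀ = T ∖ □₁»), p.77 («some domains Ω_j are equal to T_η»)] -/
theorem cubeFam_true_zero (L : ℕ) (a : Site d) (M ρ k : ℕ) : cubeFam true L a M ρ k 0 = Set.univ := by
  simp [cubeFam]

/-- `Ω_j = □_j` for every `j ≤ k` unless (`top` and `j = 0`). [folklore] -/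
private theorem cubeFam_eq_cube (top : Bool) (L : ℕ) (a : Site d) (M ρ : ℕ) {k j : ℕ} (hj : j ≤ k)
    (h : ¬ (top = true ∧ j = 0)) : cubeFam top L a M ρ k j = cube L a M ρ k j := by
  simp [cubeFam, hj, h]

/-- **«The sequence of cubes {□_j} is an admissible family of subsets satisfying (1.3), (1.4)» — THE RECORD**: for
`1 ≤ L ≤ R₁M₁` both Sect. F families are admissible domain sequences in the sense of `B8ConstraintBonds.DomainSeq`
(nesting (1.3); «Ω_j = Bʲ(Ω_j^{(j)})»; the `L^{j+1}`-collar of (1.4), here from the separation `R₁M₁Lʲ ≥ L^{j+1}`).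
[cite: Balaban1985RegularSpaces, p.99 («The sequence of cubes {□_j} is an admissible family of subsets satisfying (1.3), (1.4)»), (1.3)–(1.4) p.77, p.98] -/
theorem cubeFam_domainSeq (top : Bool) {L : ℕ} (hL : 1 ≤ L) (a : Site d) (M : ℕ) {ρ : ℕ} (hρ : L ≤ ρ) (k : ℕ) :
    DomainSeq L (cubeFam top L a M ρ k) where
  anti n := by
    by_cases hn : n + 1 ≤ k
    · rw [cubeFam_of_pos top L a M ρ (by omega) hn]
      by_cases h0 : top = true ∧ n = 0
      · obtain ⟨rfl, rfl⟩ := h0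
        rw [cubeFam_true_zero]; exact Set.subset_univ _
      · rw [cubeFam_eq_cube top L a M ρ (by omega) h0]
        exact cube_succ_subset (by omega)
    · rw [cubeFam_of_lt top L a M ρ (by omega)]; exact Set.empty_subset _
  sat n x y hxy hx := by
    by_cases hn : n ≤ k
    · by_cases h0 : top = true ∧ n = 0
      · obtain ⟨rfl, rfl⟩ := h0
        rw [cubeFam_true_zero]; exact Set.mem_univ _
      · rw [cubeFam_eq_cube top L a M ρ hn h0] at hx ⊢
        obtain ⟨z, hz, hU⟩ := (mem_cube_iff hL).mp hx
        have h1 : flm L n x = z := flm_eq_of_under hU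
        have h2 : flm L n y = z := by rw [← h1, ← blockMap_pow_eq_flm, ← blockMap_pow_eq_flm, hxy]
        exact (mem_cube_iff hL).mpr ⟨z, hz, h2 ▸ under_flm hL n y⟩
    · rw [cubeFam_of_lt top L a M ρ (by omega)] at hx; exact absurd hx (Set.notMem_empty _)
  sep n x t hx ht := by
    by_cases hn : n + 1 ≤ k
    · rw [cubeFam_of_pos top L a M ρ (by omega) hn] at hx
      by_cases h0 : top = true ∧ n = 0
      · obtain ⟨rfl, rfl⟩ := h0
        rw [cubeFam_true_zero]; exact Set.mem_univ _
      · rw [cubeFam_eq_cube top L a M ρ (by omega) h0]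
        refine add_mem_cube_of_mem_succ (by omega) hx fun i => (ht i).trans ?_
        have h : L ^ (n + 1) ≤ ρ * L ^ n := by rw [pow_succ, mul_comm]; exact Nat.mul_le_mul_right _ hρ
        exact_mod_cast h
    · rw [cubeFam_of_lt top L a M ρ (by omega)] at hx; exact absurd hx (Set.notMem_empty _)

/-! ## §5 (1.131): print's `Λ′_j` are the (1.5)-territories of the admissible family `(T, □₁, …, □_k)` -/

/-- **(1.131) = (1.5) FOR `(T, □₁, …, □_k)`**: for `j ≤ k` (`k ≥ 1`), a level-`j` site `y` (in the rescaled coordinates of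
the B7/B8 lineage) has its fine point `Lʲ•y` in `Λ_j = Ω_j^{(j)} ∖ Ω_{j+1}^{(j)}` of the record iff `y ∈ Λ′_j` of (1.131) —
`Λ′₀ = T ∖ □₁`, `Λ′_j = □_j^{(j)} ∖ □_{j+1}^{(j)}` (`1 ≤ j < k`), `Λ′_k = □_k^{(k)}`. [cite: Balaban1985RegularSpaces, (1.131) p.99, (1.5) p.77] -/
theorem smul_mem_Lam_cubeFam_iff {L : ℕ} (hL : 1 ≤ L) (a : Site d) (M ρ : ℕ) {k j : ℕ} (hk : 1 ≤ k) (hj : j ≤ k)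
    (y : Site d) : ((L : ℤ) ^ j) • y ∈ Lam L (cubeFam true L a M ρ k) j ↔ y ∈ LamP L a M ρ k j := by
  simp only [Lam, Set.mem_setOf_eq]
  rcases Nat.eq_zero_or_pos j with rfl | hj1
  · -- `Λ′₀ = T ∖ □₁`
    simp only [pow_zero, one_smul, cubeFam_true_zero, Set.mem_univ, true_and, Nat.zero_add,
      cubeFam_of_pos true L a M ρ le_rfl hk, LamP, if_true, Set.mem_setOf_eq]
    exact ⟨fun h => h.2, fun h => ⟨fun i => by rw [pow_zero]; exact one_dvd _, h⟩⟩
  · have hj0 : j ≠ 0 := by omega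
    simp only [cubeFam_of_pos true L a M ρ hj1 hj, smul_mem_cube_iff hL, LamP, if_neg hj0, Set.mem_setOf_eq]
    constructor
    · rintro ⟨-, hsq, hout⟩
      refine ⟨hsq, fun hjk hin => hout ?_⟩
      rw [cubeFam_of_pos true L a M ρ (by omega) (Nat.succ_le_of_lt hjk), smul_mem_cube_succ_iff hL a M ρ hjk]
      exact hin
    · rintro ⟨hsq, hout⟩
      refine ⟨isLevel_pow_smul L j y, hsq, fun hin => ?_⟩
      rcases Nat.lt_or_ge j k with hjk | hjk
      · rw [cubeFam_of_pos true L a M ρ (by omega) (Nat.succ_le_of_lt hjk), smul_mem_cube_succ_iff hL a M ρ hjk] at hin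
        exact hout hjk hin
      · rw [cubeFam_of_lt true L a M ρ (by omega)] at hin
        exact hin

/-! ## §6 Consequences: (1.31), (1.37), (1.42) at the crossing bonds of the Sect. F family, geometry DERIVED -/

/-- **«All sites of the contours Γ_{b₋,x} belong to Λ′_{j−1}» ON THE CUBE FAMILY** (the hypothesis `hblock` of
`B8Eq137QjEqB` §8 / `B8Eq131Derivation` §5 for `Λ := Λ′` of (1.131)): `1 ≤ L ≤ R₁M₁`, levels `j + 1 ≤ k`; if `L•y ∈ Λ′_j`
(b₋ read one level down) and `y + e_κ ∈ Λ′_{j+1}` (b₊), every level-`j` site under `y` lies in `Λ′_j`.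
[cite: Balaban1985RegularSpaces, p.82 («All sites of the contours Γ_{b₋,x} belong to Λ_{j−1}»), (1.131) p.99, (1.3)–(1.6) p.77] -/
theorem hblock_cubes {L : ℕ} (hL : 1 ≤ L) (a : Site d) (M : ℕ) {ρ : ℕ} (hρ : L ≤ ρ) {k j : ℕ} (hjk : j + 1 ≤ k)
    {y : Site d} {κ : Fin d} (hminus : (L : ℤ) • y ∈ LamP L a M ρ k j) (hplus : y + e κ ∈ LamP L a M ρ k (j + 1)) :
    ∀ x : Site d, InBox ((L : ℤ) • y) ((L : ℤ) • y + blockTop L) x → x ∈ LamP L a M ρ k j := fun x hx =>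
  (smul_mem_Lam_cubeFam_iff hL a M ρ (by omega) (by omega) x).mp
    (block_mem_Lam_of_crossing hL (cubeFam_domainSeq true hL a M hρ k)
      ((smul_mem_Lam_cubeFam_iff hL a M ρ (by omega) hjk (y + e κ)).mpr hplus).2.1
      (not_mem_succ_of_mem_Lam_smul ((smul_mem_Lam_cubeFam_iff hL a M ρ (by omega) (by omega) _).mpr hminus)) hx)

/-- **The mirrored block statement on the cube family** (`y ∈ Λ′_{j+1}` = b₋, `L•(y + e_κ) ∈ Λ′_j` = b₊ read one level
down): every level-`j` site under `y + e_κ` lies in `Λ′_j`. [cite: Balaban1985RegularSpaces, p.82, (1.131) p.99, (1.3)–(1.6) p.77] -/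
theorem hblock_cubes_mirrored {L : ℕ} (hL : 1 ≤ L) (a : Site d) (M : ℕ) {ρ : ℕ} (hρ : L ≤ ρ) {k j : ℕ}
    (hjk : j + 1 ≤ k) {y : Site d} {κ : Fin d} (hminus : y ∈ LamP L a M ρ k (j + 1))
    (hplus : (L : ℤ) • (y + e κ) ∈ LamP L a M ρ k j) :
    ∀ x : Site d, InBox ((L : ℤ) • (y + e κ)) ((L : ℤ) • (y + e κ) + blockTop L) x → x ∈ LamP L a M ρ k j :=
  fun x hx =>
  (smul_mem_Lam_cubeFam_iff hL a M ρ (by omega) (by omega) x).mp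
    (block_mem_Lam_of_crossing_mirrored hL (cubeFam_domainSeq true hL a M hρ k)
      ((smul_mem_Lam_cubeFam_iff hL a M ρ (by omega) hjk y).mpr hminus).2.1
      (not_mem_succ_of_mem_Lam_smul ((smul_mem_Lam_cubeFam_iff hL a M ρ (by omega) (by omega) _).mpr hplus)) hx)

section Consequences

variable {𝔸 : Type*} [NormedRing 𝔸] [NormOneClass 𝔸] [NormedAlgebra ℂ 𝔸] [CompleteSpace 𝔸]

omit [NormOneClass 𝔸] [CompleteSpace 𝔸] in
/-- **THE FAMILY OF (1.132) IS THE ADMISSIBLE FAMILY OF THE RECORD**: `𝔄_k({□_j}, α)` (`B8Ineq132.InAk`, which reads the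
levels `j ≤ k` only) over the record's family `cubeFam false` (`Ω₀ = □₀`) is `𝔄_k` over the family `B8Eq131Cubes.cube L a M ρ k`
for which `B8Eq131Cubes.ineq132_cubes` certifies «U₀″ ∈ 𝔄_k({□_j}, L³α₀)». [cite: Balaban1985RegularSpaces, (1.132) p.99 («U₀″ ∈ 𝔄_k({□_j}, L³α₀)»), (1.7)–(1.9) p.77] -/
theorem inAk_cubeFam_iff (L k : ℕ) (η α : ℝ) (a : Site d) (M ρ : ℕ) (V : Site d → Fin d → 𝔸ˣ) :
    B8Ineq132.InAk L k η α (cubeFam false L a M ρ k) V ↔ B8Ineq132.InAk L k η α (cube L a M ρ k) V := by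
  unfold B8Ineq132.InAk
  exact forall₂_congr fun j hj => by rw [cubeFam_false_of_le L a M ρ hj]

omit [NormOneClass 𝔸] in
/-- **(1.31), second line, ON THE SECT. F FAMILY `{□_j}` with `Λ′` of (1.131), block geometry DERIVED** (the parent's
`B8Eq131Derivation.eq131_crossing` for the typed classes (1.19) `InAx` / (1.29) `Restr129` over `Λ′`): for a level-`(j+1)`
bond with `b₋` read one level down in `Λ′_j` (`L•y ∈ Λ′_j`) and `b₊ = y + e_κ ∈ Λ′_{j+1}`, `j + 1 ≤ k`, `1 ≤ L ≤ R₁M₁`,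
`(U̿₁^{j+1})_b = exp[−i Σ_{x∈B(b₋)} L^{−d} (1/i) log(R̄ʲ_{0,b₋}V′ⱼ)(Γ_{b₋,x})] · V_b(Ū₀^{j+1}_b)⁻¹`, with the (1.13)-data `Vj`, `V`
as in the parent. [cite: Balaban1985RegularSpaces, (1.31) p.82, p.82 («All sites …»), (1.131) p.99, (1.3)–(1.6) p.77, (1.19) p.79, (1.29) p.81] -/
theorem eq131_crossing_cubes {L : ℕ} (hL : 1 ≤ L) (a : Site d) (M : ℕ) {ρ : ℕ} (hρ : L ≤ ρ) (k : ℕ)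
    (U₀ U₁ : Site d → Fin d → 𝔸ˣ) (u : Site d → 𝔸ˣ) (hAx : InAx L k (LamP L a M ρ k) U₀ (mgauge U₀ u U₁ * U₀))
    (h129 : Restr129 L k (LamP L a M ρ k) U₀ u) {j : ℕ} (hjk : j + 1 ≤ k) (y : Site d) (κ : Fin d)
    (hminus : (L : ℤ) • y ∈ LamP L a M ρ k j) (hplus : y + e κ ∈ LamP L a M ρ k (j + 1))
    (Vj V : Site d → Fin d → 𝔸ˣ)
    (h13j : B7Prop1Local.AgreeOn ((L : ℤ) • y) ((L : ℤ) • y + blockTop L) (avgIter L (mgauge U₀ u U₁ * U₀) j) Vj)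
    (h13 : avgIter L (mgauge U₀ u U₁ * U₀) (j + 1) y κ = V y κ) :
    ((dbavgCovIter L U₀ U₁ (j + 1) y κ : 𝔸ˣ) : 𝔸)
      = crossMid L (avgIter L U₀ j) (pert Vj (avgIter L U₀ j)) ((L : ℤ) • y)
          (V y κ * (avgIter L U₀ (j + 1) y κ)⁻¹) :=
  have h87 := eq87_of_inAx_restr129 L hL k (LamP L a M ρ k) U₀ U₁ u hAx h129
  eq131_crossing L hL U₀ U₁ u j y κ Vj V
    (fun x hx => h87 j (Nat.le_of_succ_le hjk) x (hblock_cubes hL a M hρ hjk hminus hplus x hx))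
    h13j (h87 (j + 1) hjk (y + e κ) hplus) h13

/-- **(1.37) «Q_j(U₀, ηA) = B» AT A CROSSING BOND OF THE SECT. F FAMILY, geometry DERIVED**
(`B8Eq137QjEqB.Qj_eq_Bcross_of_inAx_restr129` with `Λ := Λ′` of (1.131) and its `hblock` supplied by `hblock_cubes`) —
hypotheses: [3] Prop. 4's regime (as there), `InAx`, `Restr129` over `Λ′`, `L•y ∈ Λ′_j`, `y + e_κ ∈ Λ′_{j+1}`, `2 ≤ L ≤ R₁M₁`.
[cite: Balaban1985RegularSpaces, (1.37) p.82, (1.31) p.82, (1.131) p.99, (1.3)–(1.6) p.77] -/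
theorem Qj_eq_Bcross_cubes (L : ℕ) (hL : 2 ≤ L) (a : Site d) (M : ℕ) {ρ : ℕ} (hρ : L ≤ ρ) {G : Subgroup 𝔸ˣ}
    (hG : AvgClosed d L G) (k : ℕ) (U₀ : Site d → Fin d → 𝔸ˣ) (hU₀ : ∀ x κ, U₀ x κ ∈ G) {α₀ : ℝ} (hα₀ : 0 < α₀)
    (hα3 : C0 d * α₀ ≤ 1 / 3) (hα4 : 4 * α₀ ≤ c2' d L) (h40 : pdev U₀ < α₀ * (((L : ℝ) ^ k)⁻¹) ^ 2)
    (B₀ : Site d → Fin d → 𝔸) {b : ℝ} (hb : 0 ≤ b) (hB : ∀ x κ, ‖B₀ x κ‖ ≤ b)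
    (hsm : Real.exp (4 * (800 * ((d : ℝ) + 1) ^ 2 * ((d : ℝ) + 4)) * α₀)
      * (1 + 8 * (131072 * ((d : ℝ) + 1) ^ 2) * ((L : ℝ) ^ k * b)) ≤ 2)
    (hc₃ : 2 * ((L : ℝ) ^ k * b) ≤ c3 d L) (u : Site d → 𝔸ˣ)
    (hAx : InAx L k (LamP L a M ρ k) U₀ (mgauge U₀ u (expCfg B₀) * U₀)) (h129 : Restr129 L k (LamP L a M ρ k) U₀ u)
    {j : ℕ} (hjk : j + 1 ≤ k) (y : Site d) (κ : Fin d)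
    (hminus : (L : ℤ) • y ∈ LamP L a M ρ k j) (hplus : y + e κ ∈ LamP L a M ρ k (j + 1)) :
    logCovIter L U₀ B₀ (j + 1) y κ
      = I • Bcross L (avgIter L U₀ j) (tildIter L U₀ (mgauge U₀ u (expCfg B₀)) j) ((L : ℤ) • y)
          (tildIter L U₀ (mgauge U₀ u (expCfg B₀)) (j + 1) y κ) :=
  Qj_eq_Bcross_of_inAx_restr129 L hL hG k (LamP L a M ρ k) U₀ hU₀ hα₀ hα3 hα4 h40 B₀ hb hB hsm hc₃ u hAx h129 hjk
    y κ (hblock_cubes (le_trans (by norm_num) hL) a M hρ hjk hminus hplus) hplus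

/-- **(1.37), mirrored crossing bond of the Sect. F family, geometry DERIVED** (`y ∈ Λ′_{j+1}` = b₋, `L•(y + e_κ) ∈ Λ′_j` =
b₊ one level down). [cite: Balaban1985RegularSpaces, (1.37) p.82, (1.31) p.82, (1.131) p.99, (1.3)–(1.6) p.77] -/
theorem Qj_eq_BcrossMirror_cubes (L : ℕ) (hL : 2 ≤ L) (a : Site d) (M : ℕ) {ρ : ℕ} (hρ : L ≤ ρ) {G : Subgroup 𝔸ˣ}
    (hG : AvgClosed d L G) (k : ℕ) (U₀ : Site d → Fin d → 𝔸ˣ) (hU₀ : ∀ x κ, U₀ x κ ∈ G) {α₀ : ℝ} (hα₀ : 0 < α₀)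
    (hα3 : C0 d * α₀ ≤ 1 / 3) (hα4 : 4 * α₀ ≤ c2' d L) (h40 : pdev U₀ < α₀ * (((L : ℝ) ^ k)⁻¹) ^ 2)
    (B₀ : Site d → Fin d → 𝔸) {b : ℝ} (hb : 0 ≤ b) (hB : ∀ x κ, ‖B₀ x κ‖ ≤ b)
    (hsm : Real.exp (4 * (800 * ((d : ℝ) + 1) ^ 2 * ((d : ℝ) + 4)) * α₀)
      * (1 + 8 * (131072 * ((d : ℝ) + 1) ^ 2) * ((L : ℝ) ^ k * b)) ≤ 2)
    (hc₃ : 2 * ((L : ℝ) ^ k * b) ≤ c3 d L) (u : Site d → 𝔸ˣ)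
    (hAx : InAx L k (LamP L a M ρ k) U₀ (mgauge U₀ u (expCfg B₀) * U₀)) (h129 : Restr129 L k (LamP L a M ρ k) U₀ u)
    {j : ℕ} (hjk : j + 1 ≤ k) (y : Site d) (κ : Fin d)
    (hminus : y ∈ LamP L a M ρ k (j + 1)) (hplus : (L : ℤ) • (y + e κ) ∈ LamP L a M ρ k j) :
    logCovIter L U₀ B₀ (j + 1) y κ
      = I • BcrossMirror L (avgIter L U₀ j) (tildIter L U₀ (mgauge U₀ u (expCfg B₀)) j) ((L : ℤ) • (y + e κ))
          (avgIter L U₀ (j + 1) y κ) (tildIter L U₀ (mgauge U₀ u (expCfg B₀)) (j + 1) y κ) :=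
  Qj_eq_BcrossMirror_of_inAx_restr129 L hL hG k (LamP L a M ρ k) U₀ hU₀ hα₀ hα3 hα4 h40 B₀ hb hB hsm hc₃ u hAx h129
    hjk y κ hminus (hblock_cubes_mirrored (le_trans (by norm_num) hL) a M hρ hjk hminus hplus)

/-- **(1.42) clause «|Q_j(U₀, ηA)| < 2dLα₁» from (1.35), crossing bond of the Sect. F family, geometry DERIVED**
(`B8Eq137QjEqB.norm_Qj_lt_crossing_of_inAx_restr129` with `Λ := Λ′` and `hblock` from `hblock_cubes`).
[cite: Balaban1985RegularSpaces, (1.42) p.83, (1.37) p.82, (1.35) p.82, (1.131) p.99, (1.3)–(1.6) p.77] -/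
theorem norm_Qj_lt_crossing_cubes (L : ℕ) (hd : 1 ≤ d) (hL : 2 ≤ L) (a : Site d) (M : ℕ) {ρ : ℕ} (hρ : L ≤ ρ)
    {G : Subgroup 𝔸ˣ} (hG : AvgClosed d L G) (k : ℕ) (U₀ : Site d → Fin d → 𝔸ˣ) (hU₀ : ∀ x κ, U₀ x κ ∈ G)
    {α₀ : ℝ} (hα₀ : 0 < α₀) (hα3 : C0 d * α₀ ≤ 1 / 3) (hα4 : 4 * α₀ ≤ c2' d L)
    (h40 : pdev U₀ < α₀ * (((L : ℝ) ^ k)⁻¹) ^ 2) (B₀ : Site d → Fin d → 𝔸) {b : ℝ} (hb : 0 ≤ b)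
    (hB : ∀ x κ, ‖B₀ x κ‖ ≤ b)
    (hsm : Real.exp (4 * (800 * ((d : ℝ) + 1) ^ 2 * ((d : ℝ) + 4)) * α₀)
      * (1 + 8 * (131072 * ((d : ℝ) + 1) ^ 2) * ((L : ℝ) ^ k * b)) ≤ 2)
    (hc₃ : 2 * ((L : ℝ) ^ k * b) ≤ c3 d L) (u : Site d → 𝔸ˣ)
    (hAx : InAx L k (LamP L a M ρ k) U₀ (mgauge U₀ u (expCfg B₀) * U₀)) (h129 : Restr129 L k (LamP L a M ρ k) U₀ u)
    {j : ℕ} (hjk : j + 1 ≤ k) (y : Site d) (κ : Fin d)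
    (hminus : (L : ℤ) • y ∈ LamP L a M ρ k j) (hplus : y + e κ ∈ LamP L a M ρ k (j + 1))
    (hU : ∀ x μ, avgIter L (mgauge U₀ u (expCfg B₀) * U₀) j x μ ∈ U1 𝔸)
    (hW : avgIter L (mgauge U₀ u (expCfg B₀) * U₀) (j + 1) y κ ∈ U1 𝔸)
    {α₁ : ℝ} (hα : 0 < α₁) (hsmall : (d : ℝ) * L * α₁ ≤ 1 / 8)
    (h135 : ∀ (z : Site d) (μ : Fin d), (L : ℤ) • y ≤ z → z + e μ ≤ (L : ℤ) • y + blockTop L →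
      ‖(avgIter L (mgauge U₀ u (expCfg B₀) * U₀) j z μ : 𝔸) - (avgIter L U₀ j z μ : 𝔸)‖ ≤ α₁)
    (h135b : ‖(avgIter L (mgauge U₀ u (expCfg B₀) * U₀) (j + 1) y κ : 𝔸) - (avgIter L U₀ (j + 1) y κ : 𝔸)‖ ≤ α₁) :
    ‖logCovIter L U₀ B₀ (j + 1) y κ‖ < 2 * d * L * α₁ :=
  norm_Qj_lt_crossing_of_inAx_restr129 L hd hL hG k (LamP L a M ρ k) U₀ hU₀ hα₀ hα3 hα4 h40 B₀ hb hB hsm hc₃ u hAx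
    h129 hjk y κ (hblock_cubes (le_trans (by norm_num) hL) a M hρ hjk hminus hplus) hplus hU hW hα hsmall h135 h135b

end Consequences

end Literature.MathematicalPhysics.QuantumFieldTheory.Balaban1983to89.B8Eq131CubesAdmissible

end
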